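import Literature.AlgebraicGeometry.Frobenioids.PadicFrobenioidRelTop
import Literature.AlgebraicGeometry.Frobenioids.ModelFrobenioidEndMonoid
import HarnessLib

/-!
# Frobenioids II, Theorem 2.4 (ii) junction, piece P2: "`Ψ_B` preserves effective divisors" FROM "`Ψ` preserves `O^▷(−)`"

Mochizuki, *The geometry of Frobenioids II*, Kyushu J. Math. **62** (2008) 401–460, §2, proof of Theorem 2.4, p. 20 ll. 21–27
[cite: MochizukiFrdII2008, Thm 2.4 (i) p.20]: "`Ψ` preserves «`O^▷(−)`» [cf. [Mzk5], Corollary 4.10; Corollary 4.11, (iii)]";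
Mochizuki, *The geometry of Frobenioids I*, Kyushu J. Math. **62** (2008), Theorem 5.2 (i) p. 100 [cite: MochizukiFrdI2008,
Thm. 5.2(i) p.100] (model Frobenioids: a morphism is the data `(deg_Fr, Base, Div, u)` subject to
`deg_Fr · α + Div = Base^*(β) + Div_B(u)`; `O^▷(A)` = the base-identity linear endomorphisms, whose divisors are the EFFECTIVE
`Div_B(u)`).

PROOF-ONLY companion (cell abc-iut, row «T24ii-J2» piece P2; seat abc-iut-L1-d3 gen 6).  abc-iut-w5-d229's Theorem 2.4 (ii)
capstone `BaseGaloisSystem.exists_pairIso_absAnabChart_unitsTransport` (`PadicFrobenioidPairIsoOrientation.lean`) carries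
the ORIENTATION input `hpos` — "`Ψ_B` carries rational functions with effective divisor to rational functions with effective
divisor" — as a binder (discharged in `PadicFrobenioidPairIsoUnitsTransport` from an extra divisor component `Ψ_Φ` with its
square `hsq`, [FrdI] Cor. 4.11 (iii) data).  Here `hpos` is derived WITHOUT `Ψ_Φ`, from the two inputs the junction holds
anyway: "`Ψ` preserves `O^▷(−)`" (hO — a THEOREM for equivalences of `p`-adic Frobenioids, abc-iut-L1-t7 gen 6's
`PadicFrd.map_mem_endSubmonoid_iff` from [FrdI] Thm. 3.4 (iv)) and the printed compatibility of `Ψ_B` with `Ψ` on `O^▷(−)`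
(hΨB, [FrdI] Cor. 4.10 / 4.11 (ii), the ONE hypothesis binder of the junction):
* §1 `ModelFrobenioid.exists_divB_eq_of_of_map_mem_endSubmonoid` — GENERIC over model Frobenioids: `b ∈ B₁(A)` with
  `Div_B(b) = c` effective is the rational function `u_f` of the endomorphism `f = (1, id, c, b) ∈ O^▷((A, α))` (abc-iut-w5-d248's `unitEnd` /
  `exists_mem_endSubmonoid_unit_eq`, `ModelFrobenioidEndMonoid.lean`); `Ψ f ∈ O^▷`
  forces `Div(Ψ f) = Div_B(u_{Ψ f})` effective ([FrdI] Thm. 5.2 (i) relation (d), `of_div_eq_divB_unit_of_mem_endSubmonoid`),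
  and `u_{Ψ f} = η^* Ψ_B(b)` (hΨB) transports effectivity back along the base isomorphism `η`;
* §2 `PadicFrd.Datum.hpos_of_equivalence` — the `hpos` binder of abc-iut-w5-d229's capstone, at every base object, for an
  EQUIVALENCE `Ψ` of `p`-adic Frobenioids over the genuine absolute bases `CosetCat Πᵢ` (`Πᵢ` temp-slim tempered), from hΨB
  alone (hO supplied by `PadicFrd.map_mem_endSubmonoid_iff` at `Ψ♭` through abc-iut-L1-t7 gen 7's `relTopEquivalence` /
  `toRelTopFrob_map_mem_endSubmonoid_iff`, inlined).
Theorems only; nothing here concerns [IUTchIII].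
-/

noncomputable section

namespace Literature.AlgebraicGeometry.Frobenioids

open CategoryTheory Opposite Function

/-! ### §1 Generic: effectivity of `Ψ_B(b)` from `Ψ f ∈ O^▷` for the endomorphism `f = (1, id, Div_B b, b)` -/

namespace ModelFrobenioid

universe w v₁ v₂ u₁ u₂

variable {D₁ : Type u₁} [Category.{v₁} D₁] {D₂ : Type u₂} [Category.{v₂} D₂]
  {Φ₁ B₁ : D₁ᵒᵖ ⥤ CommMonCat.{w}} {DivB₁ : B₁ ⟶ monoidGp Φ₁}
  {Φ₂ B₂ : D₂ᵒᵖ ⥤ CommMonCat.{w}} {DivB₂ : B₂ ⟶ monoidGp Φ₂}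

/-- **"`Ψ_B` preserves effective divisors" from "`Ψ` preserves `O^▷(−)`"** (generic over model Frobenioids).  Let
`Ψ : C₁ → C₂` be a functor between model Frobenioids carrying `O^▷(X)` into `O^▷(Ψ X)` (hO), `η : (Ψ X)_D ≅ A₂` a base
identification, and `Ψ_B : B₁(X_D) → B₂(A₂)` with `u_{Ψ f} = η^*(Ψ_B(u_f))` on `O^▷(X)` (hΨB).  Then every `b ∈ B₁(X_D)` with
effective divisor `Div_B(b) = c` has `Div_B(Ψ_B(b)) = c₂` effective, `c₂ = (η⁻¹)^* Div(Ψ f)` for `f = (1, id, c, b)`.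
[cite: MochizukiFrdII2008, Thm 2.4 (i) p.20] -/
theorem exists_divB_eq_of_of_map_mem_endSubmonoid (F : ModelFrobenioid Φ₁ B₁ DivB₁ ⥤ ModelFrobenioid Φ₂ B₂ DivB₂)
    (X : ModelFrobenioid Φ₁ B₁ DivB₁)
    (hO : ∀ f : X ⟶ X, f ∈ PreFrobenioid.endSubmonoid (toElem Φ₁ B₁ DivB₁) X →
      F.map f ∈ PreFrobenioid.endSubmonoid (toElem Φ₂ B₂ DivB₂) (F.obj X))
    {A₂ : D₂} (η : (F.obj X).base ≅ A₂) (ΨB : B₁.obj (op X.base) → B₂.obj (op A₂))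
    (hΨB : ∀ f : X ⟶ X, f ∈ PreFrobenioid.endSubmonoid (toElem Φ₁ B₁ DivB₁) X →
      unit (F.map f) = (B₂.map η.hom.op).hom (ΨB (unit f)))
    (b : B₁.obj (op X.base)) (c : Φ₁.obj (op X.base))
    (h : divB Φ₁ B₁ DivB₁ (op X.base) b = Algebra.GrothendieckGroup.of c) :
    ∃ c₂ : Φ₂.obj (op A₂), divB Φ₂ B₂ DivB₂ (op A₂) (ΨB b) = Algebra.GrothendieckGroup.of c₂ := by
  obtain ⟨f, hf, hfu, -⟩ := exists_mem_endSubmonoid_unit_eq X c b h.symm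
  refine ⟨(Φ₂.map η.inv.op).hom (div (F.map f)), ?_⟩
  -- `Div(Ψ f) = Div_B(u_{Ψ f}) = Div_B(η^* Ψ_B b) = η^* Div_B(Ψ_B b)` in `Φ₂((Ψ X)_D)^gp`
  have h1 : pullGp Φ₂ η.hom (divB Φ₂ B₂ DivB₂ (op A₂) (ΨB b)) = Algebra.GrothendieckGroup.of (div (F.map f)) := by
    rw [pullGp_divB, ← hfu, ← hΨB f hf, of_div_eq_divB_unit_of_mem_endSubmonoid (hO f hf)]
  -- pull back along `η⁻¹`
  have h2 : divB Φ₂ B₂ DivB₂ (op A₂) (ΨB b) =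
      pullGp Φ₂ η.inv (pullGp Φ₂ η.hom (divB Φ₂ B₂ DivB₂ (op A₂) (ΨB b))) := by
    rw [← pullGp_comp, Iso.inv_hom_id, pullGp_id]
  rw [h2, h1, pullGp_of]

end ModelFrobenioid

/-! ### §2 The `hpos` binder of abc-iut-w5-d229's capstone, for an equivalence of `p`-adic Frobenioids -/

namespace PadicFrd.Datum

open Literature.AnabelianGeometry.SemiGraphs QuasiTemperoid

variable {p₁ p₂ : ℕ} [Fact p₁.Prime] [Fact p₂.Prime]
  {P₁ : Type} [Group P₁] [TopologicalSpace P₁] [IsTopologicalGroup P₁] (hP₁ : IsTempered P₁) (hZ₁ : IsSlimGroup P₁)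
  {d₁ : Datum (CosetCat P₁) p₁}
  {P₂ : Type} [Group P₂] [TopologicalSpace P₂] [IsTopologicalGroup P₂] (hP₂ : IsTempered P₂) (hZ₂ : IsSlimGroup P₂)
  {d₂ : Datum (CosetCat P₂) p₂}
  (Ψ : d₁.frobenioid ≌ d₂.frobenioid)

include hP₁ hZ₁ hP₂ hZ₂ in
/-- **`hpos` from `hΨB`**: for an equivalence `Ψ` of `p`-adic Frobenioids over the absolute bases `CosetCat Πᵢ`, a functor
`E` on bases with `η : Ψ ⋙ Base₂ ≅ Base₁ ⋙ E` ([FrdI] Thm. 3.4 (v)) and `Ψ_B : B₁ ≅ E^op ⋙ B₂` INDUCED BY `Ψ` ON `O^▷(−)`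
(hΨB, [FrdI] Cor. 4.10 / 4.11 (ii)): `Ψ_B` carries rational functions with effective divisor to rational functions with
effective divisor — at every base object, in particular the `hpos` binder of
`BaseGaloisSystem.exists_pairIso_absAnabChart_unitsTransport` at the objects `Π₁/N_k`. [cite: MochizukiFrdII2008, Thm 2.4 (ii) p.21] -/
theorem hpos_of_equivalence (E : CosetCat P₁ ⥤ CosetCat P₂)
    (η : Ψ.functor ⋙ ModelFrobenioid.baseFunctor d₂.Φ d₂.B d₂.divB ≅ ModelFrobenioid.baseFunctor d₁.Φ d₁.B d₁.divB ⋙ E)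
    (ΨB : d₁.B ≅ E.op ⋙ d₂.B)
    (hΨB : ∀ (A : d₁.frobenioid) (f : A ⟶ A), f ∈ PreFrobenioid.endSubmonoid d₁.structureFunctor A →
      ModelFrobenioid.unit (Ψ.functor.map f) = (d₂.B.map (η.hom.app A).op).hom (ΨB.hom.app (op A.base) (ModelFrobenioid.unit f)))
    (A : CosetCat P₁) (b : d₁.B.obj (op A)) (c : d₁.Φ.obj (op A))
    (h : Frobenioids.divB d₁.Φ d₁.B d₁.divB (op A) b = Algebra.GrothendieckGroup.of c) :
    ∃ c₂ : d₂.Φ.obj (op (E.obj A)),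
      Frobenioids.divB d₂.Φ d₂.B d₂.divB (op (E.obj A)) (ΨB.hom.app (op A) b) = Algebra.GrothendieckGroup.of c₂ :=
  -- hO over the ABSOLUTE bases: abc-iut-L1-t7 gen 6's theorem ([FrdI] Thm. 3.4 (iv)) at `Ψ♭`, read back through
  -- `O^▷(A♭) = O^▷(A)` (gen 7's `toRelTopFrob_map_mem_endSubmonoid_iff`)
  ModelFrobenioid.exists_divB_eq_of_of_map_mem_endSubmonoid Ψ.functor ⟨A, 1⟩
    (fun f hf => (d₂.toRelTopFrob_map_mem_endSubmonoid_iff _ _).mp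
      ((PadicFrd.map_mem_endSubmonoid_iff hP₁ hZ₁ hP₂ hZ₂ (relTopEquivalence Ψ) (d₁.toRelTopFrob.obj ⟨A, 1⟩)
        (d₁.toRelTopFrob.map f)).mp ((d₁.toRelTopFrob_map_mem_endSubmonoid_iff _ _).mpr hf)))
    (η.app ⟨A, 1⟩) (ΨB.hom.app (op A)) (fun f hf => hΨB _ f hf) b c h

end PadicFrd.Datum

end Literature.AlgebraicGeometry.Frobenioids

end
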